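import Literature.AnabelianGeometry.EtaleTheta.Discharge.Sec4Remark411Quotient
import Literature.AnabelianGeometry.EtaleTheta.Discharge.Sec5OfConnectedTemperoid
import HarnessLib

/-!
# [EtTh] Remark 4.1.1, second clause, over the GENUINE base `D = B^temp(Π^tp_X)⁰`: the base categorical quotient is a THEOREM

Mochizuki, *The étale theta function …*, Publ. RIMS **45** (2009), §4, Remark 4.1.1, PDF p.88 (printed p.314)
[cite: MochizukiEtTh2009, Rmk 4.1.1 p.88]: "if `α : A → B` is of base-Frobenius type, then by applying Proposition 3.4,
(ii), together with the factorization of [Mzk17], Definition 1.3, (iv), (a), one verifies easily that `A → B` is a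
categorical quotient [cf. [Mzk17], §0] of `A` by the subgroup `G · μ_N(A) ⊆ Aut_C(A)` in the full subcategory of `C`
determined by the Frobenius-trivial objects".  Mochizuki, *Semi-graphs of anabelioids*, Publ. RIMS **42** (2006)
[MochizukiSemiAnbd2006], Remark 3.1.3 p.34: the Galois objects of `B^temp(Π)` are the `Π/N`, `N` open normal, with
`Aut(Π/N) = Π/N` acting by right translations.

PROOF-ONLY companion (no definition, no instance) of `BiKummer.lean` (abc-iut-L2-t3's named `Prop`
`BiKummerSetting.Remark411`), `Discharge/Sec4Remark411Quotient.lean` (conjunct (2) REDUCED to Galois descent along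
`Base(α)`: inputs (Q), (Φ), (B)) and `Discharge/Sec5OfConnectedTemperoid.lean` (abc-iut-L2-t4's
`BiKummerSetting.mkOfConnectedTemperoid`, the §4 setting over the connected temperoid `ConnectedPart (BTemp X.Pi)`);
abc-iut cell, block F, seat abc-iut-f-108 (gen 2), FACT-LIST row F-0729.  Contents:

* `GaloisObjects.exists_fac_of_autOver_invariant` — **[SemiAnbd] Rmk 3.1.3 ⇒ the base quotient property**: in
  `B^temp(Π)` (`Π` tempered), for a Galois object `A`, a connected object `B` and ANY arrow `p : A → B`, every arrow
  `q : A → Y` fixed by all automorphisms of `A` over `p` factors through `p` (uniquely: `fac_unique_of_isConnectedObj`);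
  proof: `Stab(p(x_A)) ⊆ Stab(q(x_A))` because the right translation `x_A ↦ c·x_A` (`galoisSurjOf_A(c⁻¹)`,
  abc-iut-w5-d013) lies over `p` whenever `c` fixes `p(x_A)`, then `exists_hom_of_stabilizer_le`;
  `connectedPart_existsUnique_fac_of_autOver_invariant` — the same in the full subcategory `B^temp(Π)⁰`.
* `BiKummerSetting.galOver_descent` — **input (Q) of `BaseFrobeniusTypeData.existsUnique_fac_of_descent` DISCHARGED**
  for EVERY §4 setting over `ConnectedPart (BTemp X.Pi)` (any Galois data) at objects `A` whose base `A_D` is Galois in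
  the temperoid: `Gal(A^bs/B^bs)`-fixed arrows `A_D → Y_D` factor uniquely through `Base(α)`.
* `BaseFrobeniusTypeData.existsUnique_fac_ofConnectedPart`, `remark411_ofConnectedPart_of_descent`,
  `remark411_ofConnectedPart_of_galoisDescent` — conjunct (2) / the named fact `Remark411` over the genuine base MODULO
  ONLY the Galois descent of the divisor monoid `Φ` and the rational-function monoid `B` along `Base(α)` ((Φ), (B): the
  `Gal`-invariants descend, pull-back injective) — properties of the Def. 3.3 / 3.6 DATA (`RealifiedDivisorMonoids`,
  `TemperedFrobenioid.Φ`), true for divisors (perfect `Φ`) and functions on the tempered coverings but not recorded in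
  those structures; `B` group-like is abc-iut-L2-t3's field (`ratFnFunctor_isGroupLike_holds`), `Φ` divisorial is the
  binder `hΦd` (the field `isDivisorialOn` at `treeCatVocab`: `remark411_ofConnectedPart_treeCatVocab_of_galoisDescent`).
* `remark411_mkOfConnectedTemperoid_of_galoisDescent` — the literal instance for `mkOfConnectedTemperoid`.

So, for F-0729: universal closure REFUTED (`not_forall_remark411`, span base), conjunct (1) PROVED
(`remark411_actsOver_treeCatVocab`), conjunct (2) PROVED when `Base(α)` is invertible
(`existsUnique_fac_of_isIso_baseMap`) and, over the genuine base `B^temp(Π^tp_X)⁰`, PROVED modulo (Φ)+(B) only — the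
[SemiAnbd]-ingredient print cites is no longer a hypothesis.  Nothing of the paper is restated or strengthened; no
`sorry`.  HONEST FRAMING: typed ≠ proved except for the theorems below; refereed pre-IUT material; nothing here bears
on [IUTchIII] Cor. 3.12.
-/

noncomputable section

open CategoryTheory Opposite Topology

/-! ## Part 1. `B^temp(Π)`: an arrow out of a Galois object is a categorical quotient by the automorphisms over it -/

namespace Literature.AnabelianGeometry.SemiGraphs

namespace GaloisObjects

open Literature.AlgebraicGeometry.Frobenioids (IsConnectedObj ConnectedPart connectedObjects)
open Literature.AlgebraicGeometry.Frobenioids.QuasiTemperoid.BTempConnected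

universe u

variable {G : Type u} [Group G] [TopologicalSpace G] [IsTopologicalGroup G]

omit [IsTopologicalGroup G] in
/-- Arrows of `B^temp(Π)` out of an object with a point into a connected object are epimorphic among arrows to any
`Y`: `p ≫ q' = p ≫ q'' ⇒ q' = q''` (`p` is surjective on points). [cite: MochizukiSemiAnbd2006, Rmk 3.1.3 p.34] -/
theorem fac_unique_of_isConnectedObj {A B Y : BTemp G} (hA : IsConnectedObj A) (hB : IsConnectedObj B)
    (p : A ⟶ B) {q' q'' : B ⟶ Y} (h : p ≫ q' = p ≫ q'') : q' = q'' := by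
  obtain ⟨x⟩ := nonempty_of_isConnectedObj A hA
  apply hom_ext_apply
  intro y
  obtain ⟨a, rfl⟩ := surjective_of_isConnectedObj x hB p y
  rw [← comp_apply, ← comp_apply, h]

/-- **[SemiAnbd] Rmk 3.1.3 ⇒ the categorical-quotient property of an arrow out of a Galois object.**  Let `Π` be
tempered, `A` a Galois object and `B` a connected object of `B^temp(Π)`, `p : A → B` any arrow.  Then every arrow
`q : A → Y` such that `σ ≫ q = q` for all automorphisms `σ` of `A` over `p` (`σ ≫ p = p`) factors through `p`.
Proof: with `x_A` the base point of `A ≅ Π/N_A`, an element `c` fixing `p(x_A)` yields the automorphism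
`galoisSurjOf_A(c⁻¹) : x_A ↦ c · x_A`, which lies over `p`; hence `c` fixes `q(x_A)`, i.e. `Stab(p(x_A)) ⊆ Stab(q(x_A))`,
and `q' : B = Π · p(x_A) → Y`, `g · p(x_A) ↦ g · q(x_A)` is the factorisation. [cite: MochizukiSemiAnbd2006, Rmk 3.1.3 p.34] -/
theorem exists_fac_of_autOver_invariant (hG : IsTempered G) {A B Y : BTemp G} (hA : IsGaloisObj A)
    (hB : IsConnectedObj B) (p : A ⟶ B) (q : A ⟶ Y) (hq : ∀ σ : Aut A, σ.hom ≫ p = p → σ.hom ≫ q = q) :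
    ∃ q' : B ⟶ Y, p ≫ q' = q := by
  -- `Stab(p(x_A)) ⊆ Stab(q(x_A))`
  have key : ∀ c : G, B.obj.ρ c (p.hom.hom (galoisBase hG A hA)) = p.hom.hom (galoisBase hG A hA) →
      Y.obj.ρ c (q.hom.hom (galoisBase hG A hA)) = q.hom.hom (galoisBase hG A hA) := by
    intro c hc
    have hσx : ((galoisSurjOf hG A hA c⁻¹).hom.hom.hom (galoisBase hG A hA) : A.obj.V) =
        A.obj.ρ c (galoisBase hG A hA) := by
      rw [galoisSurjOf_apply_base, inv_inv]
    have hσp : (galoisSurjOf hG A hA c⁻¹).hom ≫ p = p := by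
      refine hom_eq_of_apply_eq hA.1 _ _ (galoisBase hG A hA) ?_
      rw [comp_apply, hσx, hom_ρ, hc]
    have h : (((galoisSurjOf hG A hA c⁻¹).hom ≫ q).hom.hom (galoisBase hG A hA) : Y.obj.V) =
        q.hom.hom (galoisBase hG A hA) := by
      rw [hq _ hσp]
    rw [comp_apply, hσx, hom_ρ] at h
    exact h
  -- `B` is the orbit of `p(x_A)`; descend `q(x_A)`
  obtain ⟨q', hq'⟩ := exists_hom_of_stabilizer_le (p.hom.hom (galoisBase hG A hA))
    (fun r => exists_ρ_eq_of_isConnectedObj B hB _ r) (q.hom.hom (galoisBase hG A hA)) key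
  exact ⟨q', hom_eq_of_apply_eq hA.1 _ _ (galoisBase hG A hA) (by rw [comp_apply, hq'])⟩

/-- **Existence and uniqueness together**: for `Π` tempered, `A` Galois, `B` connected and `p : A → B` in `B^temp(Π)`,
every arrow `A → Y` invariant under the automorphisms of `A` over `p` factors UNIQUELY through `p` — `p` is a
categorical quotient of `A` by `Aut_B(A)` ([FrdI] §0). [cite: MochizukiSemiAnbd2006, Rmk 3.1.3 p.34] -/
theorem existsUnique_fac_of_autOver_invariant (hG : IsTempered G) {A B Y : BTemp G} (hA : IsGaloisObj A)
    (hB : IsConnectedObj B) (p : A ⟶ B) (q : A ⟶ Y) (hq : ∀ σ : Aut A, σ.hom ≫ p = p → σ.hom ≫ q = q) :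
    ∃! q' : B ⟶ Y, p ≫ q' = q := by
  obtain ⟨q', hq'⟩ := exists_fac_of_autOver_invariant hG hA hB p q hq
  exact ⟨q', hq', fun q'' hq'' => fac_unique_of_isConnectedObj hA.1 hB p (hq''.trans hq'.symm)⟩

/-- **The same in the connected temperoid `B^temp(Π)⁰ = ConnectedPart (BTemp Π)`** (the base category `D` of
[EtTh] Def. 3.6 (ii) / §4): for `A` Galois and any arrow `p : A → B` of `B^temp(Π)⁰`, every arrow `q : A → Y` of
`B^temp(Π)⁰` invariant under `Aut_B(A)` factors uniquely through `p`. [cite: MochizukiSemiAnbd2006, Rmk 3.1.3 p.34] -/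
theorem connectedPart_existsUnique_fac_of_autOver_invariant (hG : IsTempered G) {A B Y : ConnectedPart (BTemp G)}
    (hA : IsGaloisObj A.obj) (p : A ⟶ B) (q : A ⟶ Y) (hq : ∀ σ : Aut A, σ.hom ≫ p = p → σ.hom ≫ q = q) :
    ∃! q' : B ⟶ Y, p ≫ q' = q := by
  have hq₀ : ∀ σ : Aut A.obj, σ.hom ≫ p.hom = p.hom → σ.hom ≫ q.hom = q.hom := by
    intro σ hσ
    have h := hq ((connectedObjects (BTemp G)).isoMk σ) (ObjectProperty.hom_ext _ hσ)
    exact congrArg InducedCategory.Hom.hom h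
  obtain ⟨q₀, hq₀', -⟩ := existsUnique_fac_of_autOver_invariant hG hA B.property p.hom q.hom hq₀
  refine ⟨ObjectProperty.homMk q₀, ObjectProperty.hom_ext _ hq₀', fun q'' hq'' => ?_⟩
  apply ObjectProperty.hom_ext
  refine fac_unique_of_isConnectedObj hA.1 B.property p.hom ?_
  change p.hom ≫ q''.hom = p.hom ≫ q₀
  rw [hq₀']
  exact congrArg InducedCategory.Hom.hom hq''

end GaloisObjects

end Literature.AnabelianGeometry.SemiGraphs

/-! ## Part 2. [EtTh] Remark 4.1.1 (2) over the genuine base `D = B^temp(Π^tp_X)⁰` -/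

namespace Literature.AnabelianGeometry.EtaleTheta

open Literature.AlgebraicGeometry.Frobenioids Literature.AnabelianGeometry.SemiGraphs
  Literature.AnabelianGeometry.SemiGraphs.GaloisObjects

universe u₀ v₀ w

namespace BiKummerSetting

variable {K : Type u₀} [Field K] {X : SemiGraphs.TemperedArithmeticGroup.{u₀} K} {D₀ : Type u₀} [Category.{v₀} D₀]
  {V : FrdIMonoidStub.{w}} {T₀ : RealifiedDivisorMonoids (D₀ := D₀) V}

section AnyVocabulary

variable {VD : FrdICatStub.{u₀ + 1, u₀, w} (ConnectedPart (BTemp X.Pi))}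
  (S : BiKummerSetting X T₀ (ConnectedPart (BTemp X.Pi)) VD)

/-- **Input (Q) of `existsUnique_fac_of_descent` DISCHARGED over the genuine base** — for every §4 setting over
`D = B^temp(Π^tp_X)⁰` (whatever its Galois data) and every `α : A → B` of its Frobenioid whose base object `A_D` is
Galois in the temperoid ([SemiAnbd] Def. 3.1 (iv)): every arrow `A_D → Y_D` of `D` fixed by
`Gal(A^bs/B^bs) = Aut_{B_D}(A_D)` factors UNIQUELY through `Base(α) : A_D → B_D` — the categorical quotient in the
BASE that print obtains from the theory of temperoids. [cite: MochizukiEtTh2009, Rmk 4.1.1 p.88] -/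
theorem galOver_descent {A B : S.C} (α : A ⟶ B) (hA : SemiGraphs.IsGaloisObj A.base.obj)
    {Y₀ : ConnectedPart (BTemp X.Pi)} (q : A.base ⟶ Y₀) (hq : ∀ g ∈ S.galOver α, g.hom ≫ q = q) :
    ∃! q' : B.base ⟶ Y₀, ModelFrobenioid.baseMap α ≫ q' = q :=
  connectedPart_existsUnique_fac_of_autOver_invariant X.isTempered hA (ModelFrobenioid.baseMap α) q
    fun σ hσ => hq σ hσ

namespace BaseFrobeniusTypeData

variable {S} {A B : S.C} {α : A ⟶ B}

/-- **Remark 4.1.1, second clause, over `B^temp(Π^tp_X)⁰`, MODULO the descent of `Φ` and `B` along `Base(α)` only**: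
for `α : A → B` of base-Frobenius type with data `(G, α', α'')`, `A_D` Galois in the temperoid and `Φ` divisorial, if
the `Gal(A^bs/B^bs)`-invariants of (Φ) `Φ(A_D)` and (B) `B(A_D)` descend along `Base(α)` with injective pull-back, then
every `ψ : A → Y` over which `G · μ_N(A)` acts trivially factors UNIQUELY through `α` (`Y` arbitrary).  abc-iut-f-108's
`existsUnique_fac_of_descent` with (Q) := `galOver_descent` and `B` group-like := `ratFnFunctor_isGroupLike_holds`.
[cite: MochizukiEtTh2009, Rmk 4.1.1 p.88] -/
theorem existsUnique_fac_ofConnectedPart (d : S.BaseFrobeniusTypeData α)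
    (hA : SemiGraphs.IsGaloisObj A.base.obj)
    (hΦd : Objectwise (fun M _ => IsDivisorial M) S.tf.divisorMonoid)
    (hΦ : ∀ z : S.tf.divisorMonoid.obj (op A.base), (∀ g ∈ S.galOver α, pull S.tf.divisorMonoid g.hom z = z) →
      ∃ z' : S.tf.divisorMonoid.obj (op B.base), pull S.tf.divisorMonoid (ModelFrobenioid.baseMap α) z' = z)
    (hΦinj : Function.Injective (pullGp S.tf.divisorMonoid (ModelFrobenioid.baseMap α)))
    (hB : ∀ t : S.tf.ratFnFunctor.obj (op A.base), (∀ g ∈ S.galOver α, pull S.tf.ratFnFunctor g.hom t = t) →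
      ∃ t' : S.tf.ratFnFunctor.obj (op B.base), pull S.tf.ratFnFunctor (ModelFrobenioid.baseMap α) t' = t)
    (hBinj : Function.Injective (pull S.tf.ratFnFunctor (ModelFrobenioid.baseMap α)))
    {Y : S.C} (ψ : A ⟶ Y) (hψ : ∀ γ ∈ d.G ⊔ Subgroup.closure (S.mu A (S.degFr α)), γ.hom ≫ ψ = ψ) :
    ∃! ψ' : B ⟶ Y, α ≫ ψ' = ψ :=
  d.existsUnique_fac_of_descent hΦd S.tf.ratFnFunctor_isGroupLike_holds
    (fun q hq => (S.galOver_descent α hA q hq).exists) hΦ hΦinj hB hBinj ψ hψ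

/-- The same for the data of Def. 4.1 (iv) of a setting whose Galois objects ARE the temperoid's (`hI`; definitionally
so for `mkOfConnectedTemperoid`): condition (a) "`A` Galois" supplies `A_D` Galois. [cite: MochizukiEtTh2009, Rmk 4.1.1 p.88] -/
theorem existsUnique_fac_ofConnectedPart' (d : S.BaseFrobeniusTypeData α)
    (hI : ∀ A : S.C, S.IsGalois A → SemiGraphs.IsGaloisObj A.base.obj)
    (hΦd : Objectwise (fun M _ => IsDivisorial M) S.tf.divisorMonoid)
    (hΦ : ∀ z : S.tf.divisorMonoid.obj (op A.base), (∀ g ∈ S.galOver α, pull S.tf.divisorMonoid g.hom z = z) →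
      ∃ z' : S.tf.divisorMonoid.obj (op B.base), pull S.tf.divisorMonoid (ModelFrobenioid.baseMap α) z' = z)
    (hΦinj : Function.Injective (pullGp S.tf.divisorMonoid (ModelFrobenioid.baseMap α)))
    (hB : ∀ t : S.tf.ratFnFunctor.obj (op A.base), (∀ g ∈ S.galOver α, pull S.tf.ratFnFunctor g.hom t = t) →
      ∃ t' : S.tf.ratFnFunctor.obj (op B.base), pull S.tf.ratFnFunctor (ModelFrobenioid.baseMap α) t' = t)
    (hBinj : Function.Injective (pull S.tf.ratFnFunctor (ModelFrobenioid.baseMap α)))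
    {Y : S.C} (ψ : A ⟶ Y) (hψ : ∀ γ ∈ d.G ⊔ Subgroup.closure (S.mu A (S.degFr α)), γ.hom ≫ ψ = ψ) :
    ∃! ψ' : B ⟶ Y, α ≫ ψ' = ψ :=
  d.existsUnique_fac_ofConnectedPart (hI A d.isGalois) hΦd hΦ hΦinj hB hBinj ψ hψ

end BaseFrobeniusTypeData

/-- **The named fact `Remark411` over the genuine base, modulo descent along the morphisms of base-Frobenius type**:
for a §4 setting over `D = B^temp(Π^tp_X)⁰` whose Galois objects are Galois in the temperoid (`hI`), with `Φ`
divisorial (`hΦd`), if along `Base(α)` of every `α` of base-Frobenius type the `Gal(A^bs/B^bs)`-invariants of `Φ(A_D)`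
and `B(A_D)` descend with injective pull-back (`hdesc`), then Remark 4.1.1 holds AS TYPED: `G · μ_N(A)` acts over `α`
(abc-iut-L6-t12's `remark411_actsOver`) and `α` is a categorical quotient by it among ALL objects, in particular among
the Frobenius-trivial ones. [cite: MochizukiEtTh2009, Rmk 4.1.1 p.88] -/
theorem remark411_ofConnectedPart_of_descent
    (hI : ∀ A : S.C, S.IsGalois A → SemiGraphs.IsGaloisObj A.base.obj)
    (hΦd : Objectwise (fun M _ => IsDivisorial M) S.tf.divisorMonoid)
    (hdesc : ∀ ⦃A B : S.C⦄ (α : A ⟶ B), S.IsOfBaseFrobeniusType α →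
      (∀ z : S.tf.divisorMonoid.obj (op A.base), (∀ g ∈ S.galOver α, pull S.tf.divisorMonoid g.hom z = z) →
          ∃ z' : S.tf.divisorMonoid.obj (op B.base), pull S.tf.divisorMonoid (ModelFrobenioid.baseMap α) z' = z) ∧
        Function.Injective (pullGp S.tf.divisorMonoid (ModelFrobenioid.baseMap α)) ∧
        (∀ t : S.tf.ratFnFunctor.obj (op A.base), (∀ g ∈ S.galOver α, pull S.tf.ratFnFunctor g.hom t = t) →
          ∃ t' : S.tf.ratFnFunctor.obj (op B.base), pull S.tf.ratFnFunctor (ModelFrobenioid.baseMap α) t' = t) ∧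
        Function.Injective (pull S.tf.ratFnFunctor (ModelFrobenioid.baseMap α))) :
    S.Remark411 := by
  intro A B α d
  obtain ⟨hΦ, hΦinj, hB, hBinj⟩ := hdesc α ⟨d⟩
  exact ⟨S.remark411_actsOver hΦd α d, fun Y _ ψ hψ =>
    d.existsUnique_fac_ofConnectedPart (hI A d.isGalois) hΦd hΦ hΦinj hB hBinj ψ hψ⟩

/-- **The named fact `Remark411` over the genuine base, modulo GALOIS DESCENT for `Φ` and `B`**: the same with the
descent hypotheses stated once and for all on the base category — along every arrow `p : A_D → B_D` of
`B^temp(Π^tp_X)⁰` out of a Galois object, the `Aut_{B_D}(A_D)`-invariant elements of `Φ(A_D)` (resp. `B(A_D)`) are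
pull-backs from `B_D` and pull-back along `p` is injective on `Φ(B_D)^gp` (resp. `B(B_D)`) — as holds for (perfect
monoids of) divisors and for meromorphic functions on the tempered coverings, the origin of the Def. 3.3 data.
[cite: MochizukiEtTh2009, Rmk 4.1.1 p.88] -/
theorem remark411_ofConnectedPart_of_galoisDescent
    (hI : ∀ A : S.C, S.IsGalois A → SemiGraphs.IsGaloisObj A.base.obj)
    (hΦd : Objectwise (fun M _ => IsDivisorial M) S.tf.divisorMonoid)
    (hΦdesc : ∀ ⦃A₁ B₁ : ConnectedPart (BTemp X.Pi)⦄ (p : A₁ ⟶ B₁), SemiGraphs.IsGaloisObj A₁.obj →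
      (∀ z : S.tf.divisorMonoid.obj (op A₁), (∀ g : Aut A₁, g.hom ≫ p = p → pull S.tf.divisorMonoid g.hom z = z) →
          ∃ z' : S.tf.divisorMonoid.obj (op B₁), pull S.tf.divisorMonoid p z' = z) ∧
        Function.Injective (pullGp S.tf.divisorMonoid p))
    (hBdesc : ∀ ⦃A₁ B₁ : ConnectedPart (BTemp X.Pi)⦄ (p : A₁ ⟶ B₁), SemiGraphs.IsGaloisObj A₁.obj →
      (∀ t : S.tf.ratFnFunctor.obj (op A₁), (∀ g : Aut A₁, g.hom ≫ p = p → pull S.tf.ratFnFunctor g.hom t = t) →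
          ∃ t' : S.tf.ratFnFunctor.obj (op B₁), pull S.tf.ratFnFunctor p t' = t) ∧
        Function.Injective (pull S.tf.ratFnFunctor p)) :
    S.Remark411 := by
  refine S.remark411_ofConnectedPart_of_descent hI hΦd fun A B α hα => ?_
  obtain ⟨d⟩ := hα
  have hA : SemiGraphs.IsGaloisObj A.base.obj := hI A d.isGalois
  obtain ⟨hΦ, hΦinj⟩ := hΦdesc (ModelFrobenioid.baseMap α) hA
  obtain ⟨hB, hBinj⟩ := hBdesc (ModelFrobenioid.baseMap α) hA
  exact ⟨fun z hz => hΦ z fun g hg => hz g hg, hΦinj, fun t ht => hB t fun g hg => ht g hg, hBinj⟩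

end AnyVocabulary

section TreeCatVocab

variable {IR ISR : ((ConnectedPart (BTemp X.Pi))ᵒᵖ ⥤ CommMonCat.{w}) → Prop}
  (S : BiKummerSetting X T₀ (ConnectedPart (BTemp X.Pi)) (treeCatVocab (ConnectedPart (BTemp X.Pi)) IR ISR))

/-- **At the canonical [FrdI] category vocabulary `treeCatVocab` the binder `hΦd` is the interface field**
(`TemperedFrobenioid.isDivisorial_divisorMonoid`): over `B^temp(Π^tp_X)⁰`, `Remark411` holds modulo the Galois descent
of `Φ` and `B` ONLY (and `hI`, definitionally true for `mkOfConnectedTemperoid`). [cite: MochizukiEtTh2009, Rmk 4.1.1 p.88] -/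
theorem remark411_ofConnectedPart_treeCatVocab_of_galoisDescent
    (hI : ∀ A : S.C, S.IsGalois A → SemiGraphs.IsGaloisObj A.base.obj)
    (hΦdesc : ∀ ⦃A₁ B₁ : ConnectedPart (BTemp X.Pi)⦄ (p : A₁ ⟶ B₁), SemiGraphs.IsGaloisObj A₁.obj →
      (∀ z : S.tf.divisorMonoid.obj (op A₁), (∀ g : Aut A₁, g.hom ≫ p = p → pull S.tf.divisorMonoid g.hom z = z) →
          ∃ z' : S.tf.divisorMonoid.obj (op B₁), pull S.tf.divisorMonoid p z' = z) ∧
        Function.Injective (pullGp S.tf.divisorMonoid p))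
    (hBdesc : ∀ ⦃A₁ B₁ : ConnectedPart (BTemp X.Pi)⦄ (p : A₁ ⟶ B₁), SemiGraphs.IsGaloisObj A₁.obj →
      (∀ t : S.tf.ratFnFunctor.obj (op A₁), (∀ g : Aut A₁, g.hom ≫ p = p → pull S.tf.ratFnFunctor g.hom t = t) →
          ∃ t' : S.tf.ratFnFunctor.obj (op B₁), pull S.tf.ratFnFunctor p t' = t) ∧
        Function.Injective (pull S.tf.ratFnFunctor p)) :
    S.Remark411 :=
  S.remark411_ofConnectedPart_of_galoisDescent hI S.tf.isDivisorial_divisorMonoid hΦdesc hBdesc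

end TreeCatVocab

/-! ### The literal instance for abc-iut-L2-t4's `BiKummerSetting.mkOfConnectedTemperoid` -/

section MkOfConnectedTemperoid

variable (X) {VD : FrdICatStub.{u₀ + 1, u₀, w} (ConnectedPart (BTemp X.Pi))}
  (tf : TemperedFrobenioid T₀ (ConnectedPart (BTemp X.Pi)) VD) (hZ : tf.monoidType = MonoidType.Z)
  (hP : ∀ A : (ConnectedPart (BTemp X.Pi))ᵒᵖ, IsPerfect (tf.Φ.carrier A))
  (NH : Subgroup (Field.absoluteGaloisGroup K) → tf.category → ℕ+ → Prop) (A₀ : tf.category)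
  (hA₀ : PreFrobenioid.IsFrobeniusTrivial tf.toElem A₀) (hA₀' : SemiGraphs.IsGaloisObj A₀.base.obj)

/-- **(Q) for the setting `mkOfConnectedTemperoid`, NO residual binder**: along `Base(α)` of every morphism `α` of
base-Frobenius type, `Gal(A^bs/B^bs)`-fixed arrows of the base descend uniquely (condition (a) "`A` Galois" of
Def. 4.1 (iv) is Galois-in-the-temperoid by definition of the setting). [cite: MochizukiEtTh2009, Rmk 4.1.1 p.88] -/
theorem BaseFrobeniusTypeData.galOver_descent_mkOfConnectedTemperoid
    {A B : (mkOfConnectedTemperoid X tf hZ hP NH A₀ hA₀ hA₀').C} {α : A ⟶ B}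
    (d : (mkOfConnectedTemperoid X tf hZ hP NH A₀ hA₀ hA₀').BaseFrobeniusTypeData α)
    {Y₀ : ConnectedPart (BTemp X.Pi)} (q : A.base ⟶ Y₀)
    (hq : ∀ g ∈ (mkOfConnectedTemperoid X tf hZ hP NH A₀ hA₀ hA₀').galOver α, g.hom ≫ q = q) :
    ∃! q' : B.base ⟶ Y₀, ModelFrobenioid.baseMap α ≫ q' = q :=
  (mkOfConnectedTemperoid X tf hZ hP NH A₀ hA₀ hA₀').galOver_descent α d.isGalois q hq

/-- **`Remark411` for the setting `mkOfConnectedTemperoid` modulo the Galois descent of `Φ` and `B`** (and `Φ`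
divisorial, `hΦd`; at `treeCatVocab` that binder is the field `tf.isDivisorial_divisorMonoid`).
[cite: MochizukiEtTh2009, Rmk 4.1.1 p.88] -/
theorem remark411_mkOfConnectedTemperoid_of_galoisDescent
    (hΦd : Objectwise (fun M _ => IsDivisorial M) tf.divisorMonoid)
    (hΦdesc : ∀ ⦃A₁ B₁ : ConnectedPart (BTemp X.Pi)⦄ (p : A₁ ⟶ B₁), SemiGraphs.IsGaloisObj A₁.obj →
      (∀ z : tf.divisorMonoid.obj (op A₁), (∀ g : Aut A₁, g.hom ≫ p = p → pull tf.divisorMonoid g.hom z = z) →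
          ∃ z' : tf.divisorMonoid.obj (op B₁), pull tf.divisorMonoid p z' = z) ∧
        Function.Injective (pullGp tf.divisorMonoid p))
    (hBdesc : ∀ ⦃A₁ B₁ : ConnectedPart (BTemp X.Pi)⦄ (p : A₁ ⟶ B₁), SemiGraphs.IsGaloisObj A₁.obj →
      (∀ t : tf.ratFnFunctor.obj (op A₁), (∀ g : Aut A₁, g.hom ≫ p = p → pull tf.ratFnFunctor g.hom t = t) →
          ∃ t' : tf.ratFnFunctor.obj (op B₁), pull tf.ratFnFunctor p t' = t) ∧
        Function.Injective (pull tf.ratFnFunctor p)) :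
    (mkOfConnectedTemperoid X tf hZ hP NH A₀ hA₀ hA₀').Remark411 :=
  (mkOfConnectedTemperoid X tf hZ hP NH A₀ hA₀ hA₀').remark411_ofConnectedPart_of_galoisDescent (fun _ h => h)
    hΦd hΦdesc hBdesc

end MkOfConnectedTemperoid

end BiKummerSetting

end Literature.AnabelianGeometry.EtaleTheta

end
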